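import Summits.QuantumFields.YangMills.Theorems.BalabanUVNodesN15TwoSpacingGluingDefect
import Summits.QuantumFields.YangMills.Theorems.BalabanUVNodesN15BackgroundLayerEntriesOfLetters
import HarnessLib

/-!
# THE GLUING STEP AT TWO LATTICE SPACINGS — THE SOCKET: `T4EtaRate.NE2PlusOperator` BY NAME for a family of GLUED propagators `G = G₀(1 − R)⁻¹`, all four (3.42)
# entries, from the letters of the parametrix pairs at both spacings — with BOTH printed guards of [B9] Thm 3.1 doing work: «M ≥ M₁» = the convergence of the expansion
# (`R ≤ (κ₀∕M)e^{−δd}`, `M ≥ 2κ₀c_r`), «Mα₀ ≤ a₀» = the window in which the cube letters are demanded (dag-n15-c g11, FILE 50; N15 = NE2, s1 «background-layer OPERATOR ingredient»)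

Cell `pub-ymgap`, seat `pub-ymgap-dag-n15-c` (R134 (a); HUMAN RULING D-0062), generation 11.  `bears_on: R4∕N15 · K3⁷ SpineGivenEndpointR13SepCoPH (stmt-QuantumFields-20544)`.
Filed `--supports stmt-QuantumFields-20544 --as helper` — COUNT-NEUTRAL.  Two plumbing `def`s (`gluedOps`, the letter bundle `GluedLetters`), the rest theorems; 0 `sorry`.  Imports BY NAME FILE 44
`…N15TwoSpacingGluingDefect` (`glueInv`, `glueInvL`, `inv_one_sub_le_two_of_M`, ★★★ `hasMaj_idef_glueInv` ∕ `hasMaj_idef_comp_glueInv` ∕ `hasMaj_idef_glueInvL_comp`) and g2 V0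
`…N15BackgroundLayerEntriesOfLetters` (`entryMajorant_le_etaRateShape`; through it n15-b `…N15OperatorReadout`: `opGeo`, `opFamily`, `realisedInstance`, `ne2PlusOperator_of_hasMaj`); nothing modified.

WHY.  FILES 43–49 type [B6]'s gluing at two spacings: the resummation (43), its η-defect (44), the pair from cubes with (2.91) derived (45), the (2.134) letters from cube entries via the lattice
Leibniz identity (46), Dirichlet localization (47), the entries (48), the adjoint pair (49).  THIS FILE is the consumer-facing statement in the SPINE's vocabulary: for ANY family of realised paired
instances (n15-b `realisedInstance`: coarse operator geometry `opGeo (g i) (X i) (blk i)`, the consumer's fine geometry `gf i`, backgrounds and η-pairing) whose four (3.42) entries are the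
η-defects of GLUED propagators (`gluedOps`: entry 0 `𝔇(G′, G)`, entries 1∕3 with left factors `D, D₃`, entry 2 in the adjoint arrangement `Ñ∘(G₀∘E)`), IF for `M ≥ M₅` and every `α₀ > 0`
with `Mα₀ ≤ a₀` every (3.35)-regular fine configuration `U` yields the letter bundle `GluedLetters` of the parametrix pairs — parametrix entries `≤ Ae^{−δd}`, remainders `≤ (κ₀∕M)e^{−δd}`
(THE «O(M⁻¹)» OF [B6] (2.135)), η-defects `≤ m·θ_i·e^{−δd}`, `≤ r·θ_i·e^{−δd}` with a rate `0 ≤ θ_i ≤ w_γ` (`T4EtaRateDefect.rateWeight`) — THEN `NE2PlusOperator c₃₅ pi K` holds with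
`M₅′ = max(M₅, 2κ₀c_r + 1)`, `δ₀ = δ − 2σ`, `B₀ = 4Arc_r³ + 2mc_r + 1`, the same `a₀, γ`.  Both guards are LIVE: below `M₅′` the Neumann series is not summoned; outside `Mα₀ ≤ a₀` no letter
is demanded (cf. ref-F FLAG-VACUITY-A1 on the lineage's `M ≡ 1` torus families, where the guard was inert).
* §1 def `gluedOps π G₀ R RL D D₃ E G₀′ R′ RL′ D′ D₃′ E′ : Fin 4 → ((X → ℝ) →ₗ (X′ → ℝ))`; def `GluedLetters` (14 block-majorant letters); `gluedConst`, `gluedConst_nonneg`, `gluedConst_le`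
  (`(1 − θc_r)⁻¹ ≤ 2` ⟹ `≤ 4Arc_r³ + 2mc_r`), ★★ `hasMaj_gluedOps_of_letters` (per index: all four entries `≤ gluedConst·e^{−(δ−2σ)d}` — FILE 44's three ★★★ theorems);
* §2 ★★★ **`ne2PlusOperator_glued_of_letters`**.

HONEST FRAMING ∕ LIMITS.  Quantifier bookkeeping over FILE 44 ([B9] Thm 3.1 p.397 = QUANTIFIER TEMPLATE; [B6] (2.91), (2.135)–(2.136) = MECHANISM; nothing of [B6]∕[B9] asserted).  The letter bundle
is the HYPOTHESIS (FILES 45–49 reduce it to cube entries + partition + `W`-letters; the cube letters themselves — the lineage's perturbative device on Dirichlet cubes in the cube's (3.35) gauge,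
dag-n15-w3's (t5), dag-n15-a's reflected-cube `U ≡ 1` letters — are located, not in the tree).  NE2⁺ NOT PRINTED, NOT proved; N15 NOT discharged; counts of record UNMOVED (typed 28∕28 ·
discharged 5∕27); one finite 𝕋⁴ at fixed ε — NOT infinite volume, NOT OS on ℝ⁴, NOT a mass gap, NOT Clay; R4 closes the conditional finite-𝕋⁴ rung `BalabanLadder.UV` only.  Restate-immune.
-/

noncomputable section

namespace Summit.QuantumFields.YangMills.BalabanUVNodes.N15.Gluing

open Literature.MathematicalPhysics.QuantumFieldTheory.Balaban1983to89
open Literature.MathematicalPhysics.QuantumFieldTheory.Balaban1983to89.B11SectG (BlockNorm HasMaj RowSum)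
open Literature.MathematicalPhysics.QuantumFieldTheory.Balaban1983to89.T4EtaRate (PairedInstance EtaPairing EtaRateIneq342 NE2PlusOperator rateFactor)
open Literature.MathematicalPhysics.QuantumFieldTheory.Balaban1983to89.T4EtaRateDefect (idef idef_apply rateWeight)
open Literature.MathematicalPhysics.QuantumFieldTheory.Balaban1983to89.T4EtaRateCoeffDefect (pull pull_apply)
open Literature.MathematicalPhysics.QuantumFieldTheory.Balaban1983to89.B6RandomWalk (Triangle254)
open Summit.QuantumFields.YangMills.BalabanUVNodes.N15.OperatorReadout (opGeo opFamily opGeo_len rateFactor_opGeo realisedInstance ne2PlusOperator_of_hasMaj)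
open Summit.QuantumFields.YangMills.BalabanUVNodes.N15.BackgroundLayer (entryMajorant_le_etaRateShape)

/-! ## §1 The glued entry operators, the letter bundle, the per-index majorants -/

section PerIndex

variable {X X' : Type} [Fintype X] [Fintype X'] [DecidableEq X] [DecidableEq X'] {g : B6.Geometry} (blk : X → g.Site) (π : X' → X) {σ cr : ℝ}

/-- **THE FOUR (3.42) ENTRY OPERATORS OF A GLUED PAIR OF RUNS** (coarse data unprimed on `X`, fine primed on `X′`): entry 0 `𝔇(G′, G)` with `G = G₀(1 − R)⁻¹`; entries 1, 3 with the
left factors `D` (`∇_ν`), `D₃` (`Δ`); entry 2 in the adjoint arrangement `(1 − R̃)⁻¹∘(G₀∘E)` (`E = ∇_ν*`). [cite: Balaban1985BackgroundPropagators, (3.42) p.397 (the four entries: shape); Balaban1984PropagatorsII, (2.136) p.247] -/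
def gluedOps (G₀ R RL D D₃ E : (X → ℝ) →ₗ[ℝ] (X → ℝ)) (G₀' R' RL' D' D₃' E' : (X' → ℝ) →ₗ[ℝ] (X' → ℝ)) : Fin 4 → ((X → ℝ) →ₗ[ℝ] (X' → ℝ)) :=
  ![idef (pull π) (pull π) (glueInv G₀' R') (glueInv G₀ R),
    idef (pull π) (pull π) (D' ∘ₗ glueInv G₀' R') (D ∘ₗ glueInv G₀ R),
    idef (pull π) (pull π) (neumannR RL' ∘ₗ (G₀' ∘ₗ E')) (neumannR RL ∘ₗ (G₀ ∘ₗ E)),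
    idef (pull π) (pull π) (D₃' ∘ₗ glueInv G₀' R') (D₃ ∘ₗ glueInv G₀ R)]

omit [DecidableEq X] [DecidableEq X'] in
/-- Entry 2's operator IS FILE 44's adjoint glued inverse followed by `E`. [folklore] -/
theorem glueInvL_comp_eq (RL G₀ E : (X → ℝ) →ₗ[ℝ] (X → ℝ)) [DecidableEq X] : glueInvL RL G₀ ∘ₗ E = neumannR RL ∘ₗ (G₀ ∘ₗ E) := by
  rw [glueInvL, LinearMap.comp_assoc]

/-- **THE LETTER BUNDLE OF THE TWO PARAMETRIX PAIRS** at one index and one configuration (`A`: dressed-parametrix majorants; `θ`: remainders; `m`, `r`: η-defects; rate `δ`): what FILES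
45–49 produce from cube data and what FILE 44 consumes. [cite: Balaban1984PropagatorsII, (2.133)–(2.135) p.247 (shapes)] -/
def GluedLetters (G₀ R RL D D₃ E : (X → ℝ) →ₗ[ℝ] (X → ℝ)) (G₀' R' RL' D' D₃' E' : (X' → ℝ) →ₗ[ℝ] (X' → ℝ)) (A θ m r δ : ℝ) : Prop :=
  HasMaj (BlockNorm.ofBlocks g (blk ∘ π)) (BlockNorm.ofBlocks g (blk ∘ π)) G₀' (fun y y' => A * Real.exp (-(δ * g.dist y y'))) ∧
  HasMaj (BlockNorm.ofBlocks g (blk ∘ π)) (BlockNorm.ofBlocks g (blk ∘ π)) (D' ∘ₗ G₀') (fun y y' => A * Real.exp (-(δ * g.dist y y'))) ∧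
  HasMaj (BlockNorm.ofBlocks g blk) (BlockNorm.ofBlocks g blk) (G₀ ∘ₗ E) (fun y y' => A * Real.exp (-(δ * g.dist y y'))) ∧
  HasMaj (BlockNorm.ofBlocks g (blk ∘ π)) (BlockNorm.ofBlocks g (blk ∘ π)) (D₃' ∘ₗ G₀') (fun y y' => A * Real.exp (-(δ * g.dist y y'))) ∧
  HasMaj (BlockNorm.ofBlocks g blk) (BlockNorm.ofBlocks g blk) R (fun y y' => θ * Real.exp (-(δ * g.dist y y'))) ∧
  HasMaj (BlockNorm.ofBlocks g (blk ∘ π)) (BlockNorm.ofBlocks g (blk ∘ π)) R' (fun y y' => θ * Real.exp (-(δ * g.dist y y'))) ∧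
  HasMaj (BlockNorm.ofBlocks g blk) (BlockNorm.ofBlocks g blk) RL (fun y y' => θ * Real.exp (-(δ * g.dist y y'))) ∧
  HasMaj (BlockNorm.ofBlocks g (blk ∘ π)) (BlockNorm.ofBlocks g (blk ∘ π)) RL' (fun y y' => θ * Real.exp (-(δ * g.dist y y'))) ∧
  HasMaj (BlockNorm.ofBlocks g blk) (BlockNorm.ofBlocks g (blk ∘ π)) (idef (pull π) (pull π) G₀' G₀) (fun y y' => m * Real.exp (-(δ * g.dist y y'))) ∧
  HasMaj (BlockNorm.ofBlocks g blk) (BlockNorm.ofBlocks g (blk ∘ π)) (idef (pull π) (pull π) (D' ∘ₗ G₀') (D ∘ₗ G₀)) (fun y y' => m * Real.exp (-(δ * g.dist y y'))) ∧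
  HasMaj (BlockNorm.ofBlocks g blk) (BlockNorm.ofBlocks g (blk ∘ π)) (idef (pull π) (pull π) (G₀' ∘ₗ E') (G₀ ∘ₗ E)) (fun y y' => m * Real.exp (-(δ * g.dist y y'))) ∧
  HasMaj (BlockNorm.ofBlocks g blk) (BlockNorm.ofBlocks g (blk ∘ π)) (idef (pull π) (pull π) (D₃' ∘ₗ G₀') (D₃ ∘ₗ G₀)) (fun y y' => m * Real.exp (-(δ * g.dist y y'))) ∧
  HasMaj (BlockNorm.ofBlocks g blk) (BlockNorm.ofBlocks g (blk ∘ π)) (idef (pull π) (pull π) R' R) (fun y y' => r * Real.exp (-(δ * g.dist y y'))) ∧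
  HasMaj (BlockNorm.ofBlocks g blk) (BlockNorm.ofBlocks g (blk ∘ π)) (idef (pull π) (pull π) RL' RL) (fun y y' => r * Real.exp (-(δ * g.dist y y')))

/-- THE COMMON CONSTANT of FILE 44's three defect theorems: `A·r·c_r³·(1 − θc_r)⁻² + m·c_r·(1 − θc_r)⁻¹`. [folklore] -/
def gluedConst (A θ m r cr : ℝ) : ℝ := A * r * cr ^ 3 * ((1 - θ * cr)⁻¹) ^ 2 + m * cr * (1 - θ * cr)⁻¹

omit [Fintype X] [Fintype X'] [DecidableEq X] [DecidableEq X'] in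
/-- Nonnegativity of the constant (`θc_r < 1`). [folklore] -/
theorem gluedConst_nonneg {A θ m r : ℝ} (hA : 0 ≤ A) (hm : 0 ≤ m) (hr : 0 ≤ r) (hcr : 0 ≤ cr) (hq : θ * cr < 1) : 0 ≤ gluedConst A θ m r cr := by
  have hinv0 : 0 ≤ (1 - θ * cr)⁻¹ := inv_nonneg.2 (by linarith)
  unfold gluedConst
  positivity

omit [Fintype X] [Fintype X'] [DecidableEq X] [DecidableEq X'] in
/-- THE `M`-LIVE BOUND of the constant: `(1 − θc_r)⁻¹ ≤ 2` ⟹ `gluedConst ≤ 4Arc_r³ + 2mc_r`. [folklore] -/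
theorem gluedConst_le {A θ m r : ℝ} (hA : 0 ≤ A) (hm : 0 ≤ m) (hr : 0 ≤ r) (hcr : 0 ≤ cr) (hq : θ * cr < 1) (h2 : (1 - θ * cr)⁻¹ ≤ 2) :
    gluedConst A θ m r cr ≤ 4 * A * r * cr ^ 3 + 2 * m * cr := by
  have hinv0 : 0 ≤ (1 - θ * cr)⁻¹ := inv_nonneg.2 (by linarith)
  have hsq : ((1 - θ * cr)⁻¹) ^ 2 ≤ 4 := by nlinarith
  unfold gluedConst
  have h1 : A * r * cr ^ 3 * ((1 - θ * cr)⁻¹) ^ 2 ≤ A * r * cr ^ 3 * 4 := mul_le_mul_of_nonneg_left hsq (by positivity)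
  have h3 : m * cr * (1 - θ * cr)⁻¹ ≤ m * cr * 2 := mul_le_mul_of_nonneg_left h2 (by positivity)
  linarith

/-- ★★ **ALL FOUR GLUED ENTRIES `≤ gluedConst·e^{−(δ−2σ)d}`** from the letter bundle, `θc_r < 1`, `2σ ≤ δ` — FILE 44's `hasMaj_idef_glueInv` (entry 0), `hasMaj_idef_comp_glueInv` (entries 1, 3),
`hasMaj_idef_glueInvL_comp` (entry 2). [cite: Balaban1984PropagatorsII, Prop. 2.6 (2.136) p.247 (entries: shape + mechanism)] -/
theorem hasMaj_gluedOps_of_letters (htri : Triangle254 g) (hd : ∀ a b : g.Site, 0 ≤ g.dist a b) (hd0 : ∀ y : g.Site, g.dist y y = 0) (hrow : RowSum g σ cr) (hσ : 0 ≤ σ)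
    (hcr : 0 ≤ cr) {G₀ R RL D D₃ E : (X → ℝ) →ₗ[ℝ] (X → ℝ)} {G₀' R' RL' D' D₃' E' : (X' → ℝ) →ₗ[ℝ] (X' → ℝ)} {A θ m r δ : ℝ} (hA : 0 ≤ A) (hθ : 0 ≤ θ) (hm : 0 ≤ m)
    (hr : 0 ≤ r) (hσδ : 2 * σ ≤ δ) (hq : θ * cr < 1) (hL : GluedLetters blk π G₀ R RL D D₃ E G₀' R' RL' D' D₃' E' A θ m r δ) (k : Fin 4) :
    HasMaj (BlockNorm.ofBlocks g blk) (BlockNorm.ofBlocks g (blk ∘ π)) (gluedOps π G₀ R RL D D₃ E G₀' R' RL' D' D₃' E' k)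
      (fun y y' => gluedConst A θ m r cr * Real.exp (-((δ - 2 * σ) * g.dist y y'))) := by
  obtain ⟨hG₀', hDG₀', hG₀E, hD₃G₀', hR, hR', hRL, hRL', hIG₀, hIDG₀, hIG₀E, hID₃G₀, hIR, hIRL⟩ := hL
  have e0 := hasMaj_idef_glueInv blk π htri hd hd0 hrow hσ hcr hA hθ hm hr hσδ hG₀' hR hR' hIG₀ hIR hq
  have e1 := hasMaj_idef_comp_glueInv blk π htri hd hd0 hrow hσ hcr hA hθ hm hr hσδ hDG₀' hR hR' hIDG₀ hIR hq
  have e2 := hasMaj_idef_glueInvL_comp blk π htri hd hd0 hrow hσ hcr hA hθ hm hr hσδ hG₀E hRL hRL' hIG₀E hIRL hq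
  have e3 := hasMaj_idef_comp_glueInv blk π htri hd hd0 hrow hσ hcr hA hθ hm hr hσδ hD₃G₀' hR hR' hID₃G₀ hIR hq
  have hc1 : ∀ y y' : g.Site, (A * ((1 - θ * cr)⁻¹ * ((1 - θ * cr)⁻¹ * r * cr) * cr) * cr + m * (1 - θ * cr)⁻¹ * cr) * Real.exp (-((δ - 2 * σ) * g.dist y y')) ≤
      gluedConst A θ m r cr * Real.exp (-((δ - 2 * σ) * g.dist y y')) := fun y y' => le_of_eq (by unfold gluedConst; ring)
  have hc2 : ∀ y y' : g.Site, ((1 - θ * cr)⁻¹ * m * cr + (1 - θ * cr)⁻¹ * (r * ((1 - θ * cr)⁻¹ * A * cr) * cr) * cr) * Real.exp (-((δ - 2 * σ) * g.dist y y')) ≤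
      gluedConst A θ m r cr * Real.exp (-((δ - 2 * σ) * g.dist y y')) := fun y y' => le_of_eq (by unfold gluedConst; ring)
  fin_cases k
  · exact e0.mono hc1
  · exact e1.mono hc1
  · exact e2.mono hc2
  · exact e3.mono hc1

end PerIndex

/-! ## §2 The node's first conjunct BY NAME for glued families — both guards live -/

section Node

variable {I : Type} (g : I → B6.Geometry) (X X' : I → Type) [∀ i, Fintype (X i)] [∀ i, Fintype (X' i)] [∀ i, DecidableEq (X i)] [∀ i, DecidableEq (X' i)]
  (blk : ∀ i, X i → (g i).Site) (π : ∀ i, X' i → X i) (gf : I → B9.Geometry) (Bc Bf : I → B9.Backgrounds)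
  (pair : ∀ i, EtaPairing (opGeo (g i) (X i) (blk i)) (gf i) (Bc i) (Bf i))
  (G₀ R RL D D₃ E : ∀ i, (Bf i).Cfg → ((X i → ℝ) →ₗ[ℝ] (X i → ℝ))) (G₀' R' RL' D' D₃' E' : ∀ i, (Bf i).Cfg → ((X' i → ℝ) →ₗ[ℝ] (X' i → ℝ)))

/-- ★★★ **NE2⁺, OPERATOR LAYER, BY NAME, FOR GLUED FAMILIES — BOTH PRINTED GUARDS LIVE.**  Realised paired instances `⟨opGeo (g i) (X i) (blk i), gf i, Bc i, Bf i, pair i⟩` (n15-b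
`realisedInstance`), [B6] carriers with a common row-sum rate `σ ≥ 0` and constant `c_r ≥ 0`, `d(y,y) = 0`, `η, L > 0`, sites of size `≥ 1`; the four (3.42) entries = `gluedOps` of parametrix
pairs depending on the fine configuration `U`.  IF there are UNIFORM `M₅ > 0`, `δ > 2σ`, `a₀ > 0`, `A, κ₀, m, r ≥ 0`, `γ > 0` and rates `0 ≤ θ_i ≤ w_γ(y)` such that for `M₅ ≤ (gf i).M`, every
`α₀ > 0` with `(gf i).Mα₀ ≤ a₀` and every `U` with `(Bf i).Reg335 c₃₅ α₀ U` the letter bundle `GluedLetters … A (κ₀∕(gf i).M) (mθ_i) (rθ_i) δ` holds, THEN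
`NE2PlusOperator c₃₅ (realisedInstance …) (fun i => opFamily (blk i) (blk i ∘ π i) (fun k U => gluedOps …))` — with `M₅′ = max M₅ (2κ₀c_r + 1)` (the expansion converges: «M ≥ M₁»),
`δ₀ = δ − 2σ`, `B₀ = 4Arc_r³ + 2mc_r + 1`, the same `a₀` («Mα₀ ≤ a₀», passed to the letters) and `γ`.
[cite: Balaban1985BackgroundPropagators, Thm 3.1 p.397 (quantifier template: «M ≥ M₁ … Mα₀ ≤ a₀»), p.399 (architecture); Balaban1984PropagatorsII, (2.135)–(2.136) p.247 (mechanism)] -/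
theorem ne2PlusOperator_glued_of_letters (c35 : ℝ) {σ cr : ℝ} (htri : ∀ i, Triangle254 (g i)) (hd : ∀ i (a b : (g i).Site), 0 ≤ (g i).dist a b)
    (hd0 : ∀ i (y : (g i).Site), (g i).dist y y = 0) (hrow : ∀ i, RowSum (g i) σ cr) (hσ : 0 ≤ σ) (hcr : 0 ≤ cr) (hη : ∀ i, 0 < (g i).eta) (hL : ∀ i, 0 < (g i).L)
    (hlen : ∀ i (y : (g i).Site), 1 ≤ (g i).len y)
    (h : ∃ M₅ δ a₀ A κ₀ m r γ : ℝ, ∃ θr : I → ℝ, 0 < M₅ ∧ 2 * σ < δ ∧ 0 < a₀ ∧ 0 ≤ A ∧ 0 ≤ κ₀ ∧ 0 ≤ m ∧ 0 ≤ r ∧ 0 < γ ∧ (∀ i, 0 ≤ θr i) ∧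
      (∀ i (y : (g i).Site), θr i ≤ rateWeight (g i) γ y) ∧
      ∀ i : I, M₅ ≤ (gf i).M → ∀ α₀ : ℝ, 0 < α₀ → (gf i).M * α₀ ≤ a₀ → ∀ U : (Bf i).Cfg, (Bf i).Reg335 c35 α₀ U →
        GluedLetters (blk i) (π i) (G₀ i U) (R i U) (RL i U) (D i U) (D₃ i U) (E i U) (G₀' i U) (R' i U) (RL' i U) (D' i U) (D₃' i U) (E' i U)
          A (κ₀ / (gf i).M) (m * θr i) (r * θr i) δ) :
    NE2PlusOperator c35 (realisedInstance g X blk gf Bc Bf pair)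
      (fun i => opFamily (blk i) (blk i ∘ π i) (fun k U => gluedOps (π i) (G₀ i U) (R i U) (RL i U) (D i U) (D₃ i U) (E i U) (G₀' i U) (R' i U) (RL' i U) (D' i U) (D₃' i U) (E' i U) k)) := by
  obtain ⟨M₅, δ, a₀, A, κ₀, m, r, γ, θr, hM₅, hσδ, ha₀, hA, hκ₀, hm, hr, hγ, hθr, hθrw, hall⟩ := h
  refine ne2PlusOperator_of_hasMaj g X X' blk (fun i => blk i ∘ π i) gf Bc Bf pair _ c35 (fun i => (hη i).le) (fun i => (hL i).le)
    ⟨max M₅ (2 * κ₀ * cr + 1), δ - 2 * σ, a₀, 4 * A * r * cr ^ 3 + 2 * m * cr + 1, γ, lt_max_of_lt_left hM₅, by linarith, ha₀, by positivity, hγ, ?_⟩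
  intro i hM α₀ hα₀ hMa U hU k
  have hM5 : M₅ ≤ (gf i).M := (le_max_left _ _).trans hM
  have hM2 : 2 * κ₀ * cr + 1 ≤ (gf i).M := (le_max_right _ _).trans hM
  have hMpos : 0 < (gf i).M := by nlinarith
  obtain ⟨hq, h2⟩ := inv_one_sub_le_two_of_M (cr := cr) (κ₀ := κ₀) hMpos (by linarith)
  have hLet := hall i hM5 α₀ hα₀ hMa U hU
  have hθi := hθr i
  have key := hasMaj_gluedOps_of_letters (blk i) (π i) (htri i) (hd i) (hd0 i) (hrow i) hσ hcr hA (div_nonneg hκ₀ hMpos.le) (mul_nonneg hm hθi) (mul_nonneg hr hθi) hσδ.le hq hLet k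
  -- the constant is linear in the rate θ_i and bounded by `B₀ − 1` in the `M`-window
  have hB : gluedConst A (κ₀ / (gf i).M) (m * θr i) (r * θr i) cr ≤ (4 * A * r * cr ^ 3 + 2 * m * cr) * θr i := by
    have := gluedConst_le (cr := cr) hA (mul_nonneg hm hθi) (mul_nonneg hr hθi) hcr hq h2
    calc gluedConst A (κ₀ / (gf i).M) (m * θr i) (r * θr i) cr ≤ 4 * A * (r * θr i) * cr ^ 3 + 2 * (m * θr i) * cr := this
      _ = (4 * A * r * cr ^ 3 + 2 * m * cr) * θr i := by ring
  have hB0 : 0 ≤ 4 * A * r * cr ^ 3 + 2 * m * cr := by positivity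
  refine (key.mono fun y y' => mul_le_mul_of_nonneg_right hB (Real.exp_nonneg _)).mono fun y y' => ?_
  exact entryMajorant_le_etaRateShape (blk i) (X := X i) (hη i) (hL i) (hlen i) hθi (hθrw i) hB0 (by linarith) k y y'

end Node

end Summit.QuantumFields.YangMills.BalabanUVNodes.N15.Gluing

end
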